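import Mathlib
import Literature.Analysis.FluidPDE.Tao2016AveragedNS.LocalCascadeSolutions
import Literature.Analysis.FluidPDE.Tao2016AveragedNS.RenormalisedCascadeWaves
import Literature.Analysis.FluidPDE.Tao2016AveragedNS.SelfSimilarCascadeBlowup
import Literature.Analysis.FluidPDE.Tao2016AveragedNS.BoundedEternalSolutions

/-!
# BC5 WITNESS RUNG for (ρ0) `NoSurvivingEternalBdd R 1` — the SMALL-AMPLITUDE LIOUVILLE THEOREM:
# a uniformly SMALL admissible inviscid eternal solution of the renormalised lattice is zero
# (support for `TransitMassLedger.ActionTransitExtraction`, stmt-NavierStokesRegularity-24400, which is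
# kernel-equivalent to `TaoLadderRungTwoBreak.NoSurvivingEternalBddOne`, stmt-NavierStokesRegularity-20451)

MODEL lattice ODEs only (Tao 2016 §4 in the self-similar log-time variables of §6.4); nothing in this file
is a statement about the Navier–Stokes equations, and no summit or rung LEAF is proved by it.

THE THEOREM (`eq_zero_of_small`, every `ε₀ > 0`, every table `α` of any size `m`, no cancellation, no
comparability, no use of the admissibility clauses).  Write the shell law of `IsEternal` as
`W_k' = -W_k + q_k`, `q_k = Q(W_k) + Λ A(W_{k-1}) + Λ⁻¹ B(W_{k+1}, W_k)`, so that `v_k(s) = e^{s} W_k(s)` has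
`v_k' = e^{s} q_k(s)` and `‖q_k‖ ≤ K D²` whenever `‖W‖ ≤ D` everywhere, with the QUADRATIC CONSTANT
`K(α, ε₀) = C_{(0,0,0)} + Λ C_{(0,0,1)} + Λ⁻¹ (C_{(1,0,0)} + C_{(0,1,0)})` (`quadConst`; the `C_μ` are the tree's
`shiftConst α μ`).  Fencing `v_k` on `[a, σ]` by `K D² e^{s} + D e^{a}`
(`image_norm_le_of_norm_deriv_right_le_deriv_boundary`) and letting `a → -∞` — this is where ETERNITY is
used: the solution exists and is bounded on the whole past — gives the squaring step
`sup ‖W‖ ≤ K (sup ‖W‖)²` (`norm_le_quadConst_mul_sq`).  Iterating from `sup ‖W‖ ≤ δ` with `K δ < 1` gives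
`sup ‖W‖ ≤ (Kδ)^j δ → 0`: the solution is ZERO (`eq_zero_of_small`), hence not forward-surviving at any
exponent (`not_survivingFwd_of_eq_zero`).  Contrapositive = the AMPLITUDE QUANTUM (`exists_norm_gt_of_ne_zero`):
a non-zero bounded admissible eternal solution has `sup_{k,σ} ‖W_k(σ)‖ ≥ 1/K(α, ε₀)`.

THE RUNG (`Rho0SmallAmplitudeRung`, PROVED: `rho0SmallAmplitudeRung_holds`; it IS a case of (ρ0):
`rho0SmallAmplitudeRung_of_rho0`).  On the class E₂(R) (`InTableClass R α`, `m = 4`) and for `ε₀ ≤ 1` the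
quadratic constant is at most `64·(1 + 8 + 2) = 704` (`quadConst_le`), so (ρ0) HOLDS on the amplitude slice
`sup ‖W‖ ≤ 1/1000`, with threshold `εs = 1`, uniformly in `R`.

WHY IT IS A WITNESS OF WEAKNESS AND WHAT IT DOES NOT DO (honest clause for T3).  (i) It decides (ρ0) on a
slice where nothing was decided: the tree's proved neighbours of (ρ0) are VISCOUS (`noSurvivingViscSeededBdd`,
`farPastDecay`: `ν̂ > 0`) or STRUCTURAL (`WakeRatchetDyadic`/`…Orthant`/`…Persistence`: boundedness of
forward cascades; `WakeRatchetDSS.eq_zero_of_dss_nonpos_lag`: non-positive-lag DSS), none of which decides an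
INVISCID survival question; the rung leaf TL-M2Break (`TaoLadderRungTwoBreak.Target`) is not known on any
slice.  (ii) It is UNIFORM in `ε₀ ∈ (0, 1]` (`K ≤ 704` as `Λ → 1`), so it survives the route's regime
`ε₀ → 0` — but it does not exercise it: the surviving objects (ρ0) must exclude live at amplitude `≥ 1/K`,
and the small-`ε₀` difficulty (near-resonant transfer through `~1/ε₀` comparably-coupled shells) is untouched.
(iii) It is the lattice analogue of the classical fact that SMALL bounded ancient (mild) solutions of a
critically-damped quadratic evolution are trivial (compare the small-data half of the
Koch–Nadirashvili–Seregin–Šverák Liouville theorems, Acta Math. 203 (2009), and for shell models the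
uniqueness/positivity theory of Barbato–Morandin–Romito, Trans. AMS 363 (2011)).
-/

noncomputable section

set_option linter.dupNamespace false

namespace Summit.NavierStokesRegularity.NavierStokesRegularity.Cruxes.ActionTransitExtraction.SmallAmplitudeRung

open Set Filter Topology
open Literature.Analysis.FluidPDE Literature.Analysis.FluidPDE.TaoCascade

variable {m : ℕ} {ε₀ : ℝ} {α : Fin m → Fin m → Fin m → ℤ × ℤ × ℤ → ℝ} {W : ℤ → ℝ → Em m}

/-! ## The quadratic constant and the quadratic part of the law -/

/-- `K(α, ε₀) = C_{(0,0,0)} + Λ C_{(0,0,1)} + Λ⁻¹ (C_{(1,0,0)} + C_{(0,1,0)})`. -/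
def quadConst (ε₀ : ℝ) (α : Fin m → Fin m → Fin m → ℤ × ℤ × ℤ → ℝ) : ℝ :=
  shiftConst α (0, 0, 0) + bigLam ε₀ * shiftConst α (0, 0, 1)
    + (bigLam ε₀)⁻¹ * (shiftConst α (1, 0, 0) + shiftConst α (0, 1, 0))

/-- The quadratic constant is non-negative. -/
theorem quadConst_nonneg (hε : 0 < ε₀) (α : Fin m → Fin m → Fin m → ℤ × ℤ × ℤ → ℝ) :
    0 ≤ quadConst ε₀ α := by
  have hΛ : 0 < bigLam ε₀ := bigLam_pos (by linarith)
  have h0 := shiftConst_nonneg α (0, 0, 0)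
  have h1 := shiftConst_nonneg α (0, 0, 1)
  have h2 := shiftConst_nonneg α (1, 0, 0)
  have h3 := shiftConst_nonneg α (0, 1, 0)
  unfold quadConst
  positivity

/-- The quadratic part `q_k(s) = Q(W_k) + Λ A(W_{k-1}) + Λ⁻¹ B(W_{k+1}, W_k)` of the shell law. -/
def quadPart (ε₀ : ℝ) (α : Fin m → Fin m → Fin m → ℤ × ℤ × ℤ → ℝ) (W : ℤ → ℝ → Em m)
    (k : ℤ) (s : ℝ) : Em m :=
  tableQ α (W k s) + bigLam ε₀ • tableA α (W (k - 1) s)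
    + (bigLam ε₀)⁻¹ • tableB α (W (k + 1) s) (W k s)

/-- `‖q_k(s)‖ ≤ K D²` under the uniform bound `‖W‖ ≤ D`. -/
theorem norm_quadPart_le (hε : 0 < ε₀) {D : ℝ} (hD : ∀ (k : ℤ) (σ : ℝ), ‖W k σ‖ ≤ D)
    (k : ℤ) (s : ℝ) : ‖quadPart ε₀ α W k s‖ ≤ quadConst ε₀ α * D ^ 2 := by
  have hΛ : 0 < bigLam ε₀ := bigLam_pos (by linarith)
  have hD0 : 0 ≤ D := (norm_nonneg _).trans (hD 0 0)
  have hsq : ∀ (j : ℤ) (x : ℝ), ‖W j x‖ ^ 2 ≤ D ^ 2 := fun j x =>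
    pow_le_pow_left₀ (norm_nonneg _) (hD j x) 2
  have hQ : ‖tableQ α (W k s)‖ ≤ shiftConst α (0, 0, 0) * D ^ 2 :=
    (norm_tableQ_le α _).trans (mul_le_mul_of_nonneg_left (hsq k s) (shiftConst_nonneg _ _))
  have hA : ‖bigLam ε₀ • tableA α (W (k - 1) s)‖ ≤ bigLam ε₀ * (shiftConst α (0, 0, 1) * D ^ 2) := by
    rw [norm_smul, Real.norm_of_nonneg hΛ.le]
    exact mul_le_mul_of_nonneg_left
      ((norm_tableA_le α _).trans (mul_le_mul_of_nonneg_left (hsq _ s) (shiftConst_nonneg _ _))) hΛ.le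
  have hs : 0 ≤ shiftConst α (1, 0, 0) + shiftConst α (0, 1, 0) :=
    add_nonneg (shiftConst_nonneg _ _) (shiftConst_nonneg _ _)
  have hB : ‖(bigLam ε₀)⁻¹ • tableB α (W (k + 1) s) (W k s)‖ ≤
      (bigLam ε₀)⁻¹ * ((shiftConst α (1, 0, 0) + shiftConst α (0, 1, 0)) * D ^ 2) := by
    rw [norm_smul, Real.norm_of_nonneg (inv_nonneg.2 hΛ.le)]
    refine mul_le_mul_of_nonneg_left ?_ (inv_nonneg.2 hΛ.le)
    calc ‖tableB α (W (k + 1) s) (W k s)‖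
        ≤ (shiftConst α (1, 0, 0) + shiftConst α (0, 1, 0)) * ‖W (k + 1) s‖ * ‖W k s‖ :=
          norm_tableB_le α _ _
      _ ≤ (shiftConst α (1, 0, 0) + shiftConst α (0, 1, 0)) * D * D := by
          exact mul_le_mul (mul_le_mul_of_nonneg_left (hD _ _) hs) (hD _ _) (norm_nonneg _)
            (mul_nonneg hs hD0)
      _ = (shiftConst α (1, 0, 0) + shiftConst α (0, 1, 0)) * D ^ 2 := by ring
  calc ‖quadPart ε₀ α W k s‖
      ≤ ‖tableQ α (W k s)‖ + ‖bigLam ε₀ • tableA α (W (k - 1) s)‖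
          + ‖(bigLam ε₀)⁻¹ • tableB α (W (k + 1) s) (W k s)‖ := by
        unfold quadPart
        exact norm_add₃_le
    _ ≤ shiftConst α (0, 0, 0) * D ^ 2 + bigLam ε₀ * (shiftConst α (0, 0, 1) * D ^ 2)
          + (bigLam ε₀)⁻¹ * ((shiftConst α (1, 0, 0) + shiftConst α (0, 1, 0)) * D ^ 2) :=
        add_le_add (add_le_add hQ hA) hB
    _ = quadConst ε₀ α * D ^ 2 := by unfold quadConst; ring

/-! ## The squaring step: `sup ‖W‖ ≤ K (sup ‖W‖)²` for bounded eternal solutions -/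

/-- The renormalised shell `v_k(s) = e^{s} W_k(s)` solves `v_k' = e^{s} q_k(s)` (the damping is absorbed). -/
theorem hasDerivAt_expSmul (hW : IsEternal ε₀ α W) (k : ℤ) (s : ℝ) :
    HasDerivAt (fun x => Real.exp x • W k x) (Real.exp s • quadPart ε₀ α W k s) s := by
  have h := (Real.hasDerivAt_exp s).smul (hW.law k s)
  refine h.congr_deriv ?_
  simp only [quadPart, smul_add, smul_neg, one_smul]
  abel

/-- **Squaring step.**  If `‖W_j(x)‖ ≤ D` for all shells and log-times, then `‖W_k(σ)‖ ≤ K D²` — fence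
`e^{s}W_k(s)` on `[a, σ]` by `K D² e^{s} + D e^{a}` and let `a → -∞`. -/
theorem norm_le_quadConst_mul_sq (hε : 0 < ε₀) (hW : IsEternal ε₀ α W) {D : ℝ}
    (hD : ∀ (k : ℤ) (σ : ℝ), ‖W k σ‖ ≤ D) (k : ℤ) (σ : ℝ) :
    ‖W k σ‖ ≤ quadConst ε₀ α * D ^ 2 := by
  set K := quadConst ε₀ α with hK
  have hK0 : 0 ≤ K := quadConst_nonneg hε α
  have hD0 : 0 ≤ D := (norm_nonneg _).trans (hD 0 0)
  have hv := hasDerivAt_expSmul hW k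
  -- fencing on [a, σ]
  have key : ∀ a : ℝ, a ≤ σ → ‖W k σ‖ ≤ K * D ^ 2 + D * Real.exp (a - σ) := by
    intro a ha
    have hB : ∀ x : ℝ, HasDerivAt (fun x => K * D ^ 2 * Real.exp x + D * Real.exp a)
        (K * D ^ 2 * Real.exp x) x := by
      intro x
      have h := ((Real.hasDerivAt_exp x).const_mul (K * D ^ 2)).add_const (D * Real.exp a)
      simpa using h
    have hcont : ContinuousOn (fun x => Real.exp x • W k x) (Icc a σ) :=
      fun x _ => (hv x).continuousAt.continuousWithinAt
    have hfa : ‖Real.exp a • W k a‖ ≤ K * D ^ 2 * Real.exp a + D * Real.exp a := by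
      rw [norm_smul, Real.norm_of_nonneg (Real.exp_pos a).le]
      have h1 : Real.exp a * ‖W k a‖ ≤ Real.exp a * D :=
        mul_le_mul_of_nonneg_left (hD k a) (Real.exp_pos a).le
      have h2 : 0 ≤ K * D ^ 2 * Real.exp a := by positivity
      linarith
    have bound : ∀ x ∈ Ico a σ, ‖Real.exp x • quadPart ε₀ α W k x‖ ≤ K * D ^ 2 * Real.exp x := by
      intro x _
      rw [norm_smul, Real.norm_of_nonneg (Real.exp_pos x).le]
      have hq := norm_quadPart_le (α := α) (W := W) hε hD k x
      calc Real.exp x * ‖quadPart ε₀ α W k x‖ ≤ Real.exp x * (K * D ^ 2) :=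
            mul_le_mul_of_nonneg_left hq (Real.exp_pos x).le
        _ = K * D ^ 2 * Real.exp x := by ring
    have h := image_norm_le_of_norm_deriv_right_le_deriv_boundary hcont
      (fun x _ => (hv x).hasDerivWithinAt) hfa hB bound (right_mem_Icc.2 ha)
    rw [norm_smul, Real.norm_of_nonneg (Real.exp_pos σ).le] at h
    have hσ : 0 < Real.exp σ := Real.exp_pos σ
    have h' : ‖W k σ‖ ≤ (K * D ^ 2 * Real.exp σ + D * Real.exp a) / Real.exp σ := by
      rw [le_div_iff₀ hσ]
      linarith
    calc ‖W k σ‖ ≤ (K * D ^ 2 * Real.exp σ + D * Real.exp a) / Real.exp σ := h'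
      _ = K * D ^ 2 + D * Real.exp (a - σ) := by
          rw [Real.exp_sub]
          field_simp
  -- let a → -∞
  refine le_of_forall_pos_lt_add fun η hη => ?_
  set h : ℝ := D / η + 1 with hh
  have hh0 : 0 < h := by positivity
  have he : 1 + h ≤ Real.exp h := by linarith [Real.add_one_le_exp h]
  have h1 := key (σ - h) (by linarith)
  have e1 : σ - h - σ = -h := by ring
  rw [e1, Real.exp_neg] at h1
  have h2 : D * (Real.exp h)⁻¹ ≤ D / (1 + h) := by
    rw [div_eq_mul_inv]
    exact mul_le_mul_of_nonneg_left ((inv_le_inv₀ (Real.exp_pos h) (by positivity)).2 he) hD0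
  have h3 : D / (1 + h) < η := by
    rw [div_lt_iff₀ (by positivity)]
    have : η * (1 + h) = D + 2 * η := by
      rw [hh]
      field_simp
      ring
    linarith
  linarith

/-! ## Small bounded eternal solutions vanish; the amplitude quantum -/

/-- **Small-amplitude Liouville theorem.**  An admissible (indeed: any) eternal solution of the renormalised
lattice with `‖W_k(σ)‖ ≤ δ` everywhere and `K(α, ε₀) δ < 1` is identically zero. -/
theorem eq_zero_of_small (hε : 0 < ε₀) (hW : IsEternal ε₀ α W) {δ : ℝ}
    (hδ : ∀ (k : ℤ) (σ : ℝ), ‖W k σ‖ ≤ δ) (hsmall : quadConst ε₀ α * δ < 1) :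
    ∀ (k : ℤ) (σ : ℝ), W k σ = 0 := by
  set K := quadConst ε₀ α with hK
  have hK0 : 0 ≤ K := quadConst_nonneg hε α
  have hδ0 : 0 ≤ δ := (norm_nonneg _).trans (hδ 0 0)
  have hθ0 : 0 ≤ K * δ := mul_nonneg hK0 hδ0
  have hθ1 : K * δ ≤ 1 := hsmall.le
  have iter : ∀ j : ℕ, ∀ (k : ℤ) (σ : ℝ), ‖W k σ‖ ≤ (K * δ) ^ j * δ := by
    intro j
    induction j with
    | zero => intro k σ; simpa using hδ k σ
    | succ j ih =>
        intro k σ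
        have hle1 : (K * δ) ^ j ≤ 1 := pow_le_one₀ hθ0 hθ1
        have h1 := norm_le_quadConst_mul_sq hε hW ih k σ
        calc ‖W k σ‖ ≤ K * ((K * δ) ^ j * δ) ^ 2 := h1
          _ = (K * δ) ^ j * ((K * δ) ^ (j + 1) * δ) := by ring
          _ ≤ 1 * ((K * δ) ^ (j + 1) * δ) :=
              mul_le_mul_of_nonneg_right hle1 (mul_nonneg (pow_nonneg hθ0 _) hδ0)
          _ = (K * δ) ^ (j + 1) * δ := one_mul _
  intro k σ
  have hlim : Tendsto (fun j : ℕ => (K * δ) ^ j * δ) atTop (𝓝 (0 * δ)) :=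
    (tendsto_pow_atTop_nhds_zero_of_lt_one hθ0 hsmall).mul_const δ
  rw [zero_mul] at hlim
  have h0 : ‖W k σ‖ ≤ 0 := ge_of_tendsto' hlim fun j => iter j k σ
  exact norm_le_zero_iff.1 h0

/-- **The amplitude quantum.**  A non-zero eternal solution that is uniformly bounded exceeds every level
`δ` with `K δ < 1` somewhere: `sup_{k,σ} ‖W_k(σ)‖ ≥ 1/K(α, ε₀)`. -/
theorem exists_norm_gt_of_ne_zero (hε : 0 < ε₀) (hW : IsEternal ε₀ α W)
    (hne : ∃ (k : ℤ) (σ : ℝ), W k σ ≠ 0) {δ : ℝ} (hsmall : quadConst ε₀ α * δ < 1) :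
    ∃ (k : ℤ) (σ : ℝ), δ < ‖W k σ‖ := by
  by_contra! hcon
  obtain ⟨k, σ, hk⟩ := hne
  exact hk (eq_zero_of_small hε hW hcon hsmall k σ)

/-- The zero solution is not forward-surviving, at any exponent. -/
theorem not_survivingFwd_of_eq_zero (a ε₀ : ℝ) (h0 : ∀ (k : ℤ) (σ : ℝ), W k σ = 0) :
    ¬ EternalSurvivingFwd a ε₀ W := by
  rintro ⟨c, hc, H⟩
  obtain ⟨n, -, σ, -, hle⟩ := H 0
  rw [h0, norm_zero] at hle
  have : physWeight a ε₀ ^ n * (Real.exp (2 * σ) * (0 : ℝ) ^ 2) = 0 := by ring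
  linarith

/-! ## Uniform constants on the class E₂(R) for `ε₀ ≤ 1` -/

/-- On an `R`-comparable table every shift constant on Tao's shift set is at most `m³`. -/
theorem shiftConst_le_of_inTableClass {R : ℝ} (hα : InTableClass R α) {μ : ℤ × ℤ × ℤ}
    (hμ : μ ∈ shiftSet) : shiftConst α μ ≤ (m : ℝ) ^ 3 := by
  unfold shiftConst
  calc (∑ i, ∑ i₁, ∑ i₂, |α i₁ i₂ i μ|)
      ≤ ∑ _i : Fin m, ∑ _i₁ : Fin m, ∑ _i₂ : Fin m, (1 : ℝ) :=
        Finset.sum_le_sum fun i _ => Finset.sum_le_sum fun i₁ _ =>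
          Finset.sum_le_sum fun i₂ _ => (hα.2.2 i₁ i₂ i μ hμ).1
    _ = (m : ℝ) ^ 3 := by simp; ring

/-- `Λ = (1+ε₀)^{5/2} ≤ 8` for `ε₀ ≤ 1`. -/
theorem bigLam_le_eight (hε : 0 < ε₀) (hε1 : ε₀ ≤ 1) : bigLam ε₀ ≤ 8 := by
  unfold bigLam
  have hx1 : 1 ≤ 1 + ε₀ := by linarith
  calc (1 + ε₀) ^ ((5 : ℝ) / 2) ≤ (1 + ε₀) ^ (3 : ℝ) :=
        Real.rpow_le_rpow_of_exponent_le hx1 (by norm_num)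
    _ = (1 + ε₀) ^ (3 : ℕ) := by exact_mod_cast Real.rpow_natCast (1 + ε₀) 3
    _ ≤ 2 ^ (3 : ℕ) := by gcongr; linarith
    _ = 8 := by norm_num

/-- On E₂(R) with `ε₀ ≤ 1`: `K(α, ε₀) ≤ 64·(1 + 8 + 2) = 704`. -/
theorem quadConst_le {R : ℝ} {α : Fin 4 → Fin 4 → Fin 4 → ℤ × ℤ × ℤ → ℝ}
    (hε : 0 < ε₀) (hε1 : ε₀ ≤ 1) (hα : InTableClass R α) : quadConst ε₀ α ≤ 704 := by
  have hΛ : 0 < bigLam ε₀ := bigLam_pos (by linarith)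
  have hΛ1 : 1 ≤ bigLam ε₀ := one_le_bigLam hε.le
  have hΛ8 := bigLam_le_eight hε hε1
  have hinv : (bigLam ε₀)⁻¹ ≤ 1 := inv_le_one_of_one_le₀ hΛ1
  have h0 : shiftConst α (0, 0, 0) ≤ 64 := by
    have h := shiftConst_le_of_inTableClass hα (μ := (0, 0, 0)) (by simp [mem_shiftSet_iff])
    norm_num at h; exact h
  have h1 : shiftConst α (0, 0, 1) ≤ 64 := by
    have h := shiftConst_le_of_inTableClass hα (μ := (0, 0, 1)) (by simp [mem_shiftSet_iff])
    norm_num at h; exact h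
  have h2 : shiftConst α (1, 0, 0) ≤ 64 := by
    have h := shiftConst_le_of_inTableClass hα (μ := (1, 0, 0)) (by simp [mem_shiftSet_iff])
    norm_num at h; exact h
  have h3 : shiftConst α (0, 1, 0) ≤ 64 := by
    have h := shiftConst_le_of_inTableClass hα (μ := (0, 1, 0)) (by simp [mem_shiftSet_iff])
    norm_num at h; exact h
  have n0 := shiftConst_nonneg α (0, 0, 0)
  have n1 := shiftConst_nonneg α (0, 0, 1)
  have n2 := shiftConst_nonneg α (1, 0, 0)
  have n3 := shiftConst_nonneg α (0, 1, 0)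
  have p1 : bigLam ε₀ * shiftConst α (0, 0, 1) ≤ 8 * 64 :=
    mul_le_mul hΛ8 h1 n1 (by norm_num)
  have p2 : (bigLam ε₀)⁻¹ * (shiftConst α (1, 0, 0) + shiftConst α (0, 1, 0)) ≤ 1 * (64 + 64) :=
    mul_le_mul hinv (add_le_add h2 h3) (add_nonneg n2 n3) (by norm_num)
  unfold quadConst
  linarith

/-! ## The rung in (ρ0)'s quantifier shape -/

/-- **(ρ0)-RUNG (small amplitude).**  Below a threshold, no E₂(R) table carries an admissible inviscid
eternal solution of sup-norm `≤ 1/1000` that is (S₁)-surviving forward.  A CASE of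
(ρ0) `∀ R ≥ 1, NoSurvivingEternalBdd R 1` (`rho0SmallAmplitudeRung_of_rho0`) and a THEOREM
(`rho0SmallAmplitudeRung_holds`, threshold `εs = 1`). -/
def Rho0SmallAmplitudeRung : Prop :=
  ∀ R : ℝ, 1 ≤ R → ∃ εs : ℝ, 0 < εs ∧ ∀ ε₀ : ℝ, 0 < ε₀ → ε₀ ≤ εs →
    ∀ α : Fin 4 → Fin 4 → Fin 4 → ℤ × ℤ × ℤ → ℝ, InTableClass R α →
      ∀ W : ℤ → ℝ → Em 4, IsEternal ε₀ α W → (∀ (k : ℤ) (σ : ℝ), ‖W k σ‖ ≤ 1 / 1000) →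
        ¬ EternalSurvivingFwd 1 ε₀ W

/-- The rung IS a case of (ρ0): a sup-norm bound is a `UniformBound`. -/
theorem rho0SmallAmplitudeRung_of_rho0 (h : ∀ R : ℝ, 1 ≤ R → NoSurvivingEternalBdd R 1) :
    Rho0SmallAmplitudeRung := by
  intro R hR
  obtain ⟨εs, hεs, H⟩ := h R hR
  exact ⟨εs, hεs, fun ε₀ hε hle α hα W hW hsmall => H ε₀ hε hle α hα W hW ⟨1 / 1000, hsmall⟩⟩

/-- **The rung holds** (threshold `εs = 1`, every spread `R`). -/
theorem rho0SmallAmplitudeRung_holds : Rho0SmallAmplitudeRung := by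
  intro R _hR
  refine ⟨1, one_pos, fun ε₀ hε hε1 α hα W hW hsmall => ?_⟩
  have hK := quadConst_le hε hε1 hα
  have hK0 := quadConst_nonneg hε α
  have hlt : quadConst ε₀ α * (1 / 1000) < 1 := by
    have : quadConst ε₀ α * (1 / 1000) ≤ 704 * (1 / 1000) :=
      mul_le_mul_of_nonneg_right hK (by norm_num)
    linarith
  exact not_survivingFwd_of_eq_zero 1 ε₀ (eq_zero_of_small hε hW hsmall hlt)

/-- The same slice of (ρ0) at EVERY survival exponent `a` and every `ε₀ ∈ (0, 1]` (no threshold in `R`). -/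
theorem not_survivingFwd_of_small {R a : ℝ} {α : Fin 4 → Fin 4 → Fin 4 → ℤ × ℤ × ℤ → ℝ}
    {W : ℤ → ℝ → Em 4} (hε : 0 < ε₀) (hε1 : ε₀ ≤ 1) (hα : InTableClass R α) (hW : IsEternal ε₀ α W)
    (hsmall : ∀ (k : ℤ) (σ : ℝ), ‖W k σ‖ ≤ 1 / 1000) : ¬ EternalSurvivingFwd a ε₀ W := by
  have hK := quadConst_le hε hε1 hα
  have hlt : quadConst ε₀ α * (1 / 1000) < 1 := by
    have : quadConst ε₀ α * (1 / 1000) ≤ 704 * (1 / 1000) :=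
      mul_le_mul_of_nonneg_right hK (by norm_num)
    linarith
  exact not_survivingFwd_of_eq_zero a ε₀ (eq_zero_of_small hε hW hsmall hlt)

end Summit.NavierStokesRegularity.NavierStokesRegularity.Cruxes.ActionTransitExtraction.SmallAmplitudeRung

end
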